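import Summits.CriticalPhenomena.PercolationContinuityZ3.Theorems.PercNearOneGluingNoHeavyLowerTailSahiOneStepSharedBitStair
import HarnessLib

/-!
# One shared coordinate: the three-chain collapse lemma (layer-cake from staircases)

Support file (prover prim-ineq-prove-3 gen 26; `--supports stmt-CriticalPhenomena-4575`; memo
`run/shared/lean/prim/prim-ineq-prove-3/FINDING-G26-ONE-SHARED-COORDINATE.md` §1, LEMMA 2).  No definitions, no sorries.

* `layerCake` — a linear functional on slot masses over `{0,1}×{0..K}` that is nonnegative on staircase slots is nonnegative on every
  slot `0 ≤ α ≤ a` monotone in the bit and cross-monotone in the private index (peel the least positive density; induction on the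
  number of positive cells);
* `collapse_stairSnd_nonneg`, **`collapse_nonneg`** — THE THREE-CHAIN COLLAPSE LEMMA WITH ONE SHARED BIT (mass form): for bit
  weights `c 0 + c 1 = 1`, pairwise log-concave private weights `a`, `b`, and slot masses `α`, `β` as above,
  `ℓ·Σ_H c α β + (Σ_L c α b)(Σ_L c a β) − ℓ·(Σ c α)(Σ c β) ≥ 0` — i.e. `Cov(f,g) ≥ P(L)·Cov(f,g | L)` for increasing `f(Z,X)`,
  `g(Z,Y)`, `L = {Z + X + Y ≤ s}`, `Z` Bernoulli, `X`, `Y` independent log-concave.  The cube theorem (`(2′)` for events sharing at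
  most one coordinate) is the next file.
-/

namespace Summit.CriticalPhenomena.PercolationContinuityZ3.Theorems

namespace SahiOneStep

namespace ThreeChain

open Finset


/-- **Layer-cake lemma (mass form).**  Let `Λ` be a functional on slot masses over the grid `{0,1}×{0..K}` (depending only on the
values on the grid, and linear), with private weights `a ≥ 0` supported in `{0..K}`, nonnegative on every staircase slot
`a k·[θ z ≤ k]` (`θ 1 ≤ θ 0`).  Then `Λ α ≥ 0` for every slot `0 ≤ α ≤ a` monotone in the bit and cross-monotone in `k`
(`α z k · a k' ≤ α z k' · a k`, `k ≤ k'`).  Proof: peel off `τ·(staircase)`, `τ` the least positive density `α/a` on the grid, and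
induct on the number of positive cells. [this work] -/
theorem layerCake (K : ℕ) (a : ℕ → ℝ) (ha : ∀ k, 0 ≤ a k) (haK : ∀ k, K < k → a k = 0) (Λ : (ℕ → ℕ → ℝ) → ℝ)
    (hdep : ∀ α α' : ℕ → ℕ → ℝ, (∀ z k, z < 2 → k < K + 1 → α z k = α' z k) → Λ α = Λ α')
    (hlin : ∀ (α s : ℕ → ℕ → ℝ) (τ : ℝ), Λ (fun z k => α z k - τ * s z k) = Λ α - τ * Λ s)
    (hstair : ∀ θ : ℕ → ℕ, θ 1 ≤ θ 0 → 0 ≤ Λ (fun z k => if θ z ≤ k then a k else 0))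
    (α : ℕ → ℕ → ℝ) (hα0 : ∀ z k, 0 ≤ α z k) (hαa : ∀ z k, α z k ≤ a k) (hαz : ∀ k, α 0 k ≤ α 1 k)
    (hαk : ∀ z k k', k ≤ k' → α z k * a k' ≤ α z k' * a k) : 0 ≤ Λ α := by
  classical
  set G : Finset (ℕ × ℕ) := (range 2) ×ˢ (range (K + 1)) with hG
  -- the base case: no positive cell on the grid
  have base : ∀ α : ℕ → ℕ → ℝ, (∀ z k, 0 ≤ α z k) →
      (G.filter (fun c => 0 < α c.1 c.2)).card = 0 → 0 ≤ Λ α := by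
    intro α hα0 hcard
    have hzero : ∀ z k, z < 2 → k < K + 1 → α z k = 0 := by
      intro z k hz hk
      by_contra hne
      have hpos : 0 < α z k := lt_of_le_of_ne (hα0 z k) (Ne.symm hne)
      have hmem : (z, k) ∈ G.filter (fun c => 0 < α c.1 c.2) :=
        Finset.mem_filter.2 ⟨Finset.mem_product.2 ⟨Finset.mem_range.2 hz, Finset.mem_range.2 hk⟩, hpos⟩
      have : 0 < (G.filter (fun c => 0 < α c.1 c.2)).card := Finset.card_pos.2 ⟨_, hmem⟩
      omega
    set s : ℕ → ℕ → ℝ := fun z k => if (fun _ : ℕ => K + 1) z ≤ k then a k else 0 with hs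
    have e1 : Λ (fun z k => s z k - 1 * s z k) = Λ s - 1 * Λ s := hlin s s 1
    have e2 : Λ (fun z k => s z k - 1 * s z k) = Λ α :=
      hdep _ _ fun z k hz hk => by rw [hzero z k hz hk]; ring
    rw [← e2, e1]; simp
  suffices main : ∀ n : ℕ, ∀ α : ℕ → ℕ → ℝ, (∀ z k, 0 ≤ α z k) → (∀ z k, α z k ≤ a k) → (∀ k, α 0 k ≤ α 1 k) →
      (∀ z k k', k ≤ k' → α z k * a k' ≤ α z k' * a k) → (G.filter (fun c => 0 < α c.1 c.2)).card ≤ n → 0 ≤ Λ α by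
    exact main _ α hα0 hαa hαz hαk le_rfl
  intro n
  induction n with
  | zero =>
    intro α hα0 hαa hαz hαk hcard
    exact base α hα0 (by omega)
  | succ n ih =>
    intro α hα0 hαa hαz hαk hcard
    set P := G.filter (fun c => 0 < α c.1 c.2) with hP
    by_cases hPne : P.Nonempty
    swap
    · exact base α hα0 (Finset.card_eq_zero.2 (Finset.not_nonempty_iff_eq_empty.1 hPne))
    -- the least positive density
    obtain ⟨cm, hcmP, hmin⟩ := Finset.exists_min_image P (fun c => α c.1 c.2 / a c.2) hPne
    have hcm := Finset.mem_filter.1 hcmP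
    have hcmG := Finset.mem_product.1 hcm.1
    have hcmz : cm.1 < 2 := Finset.mem_range.1 hcmG.1
    have hcmpos : 0 < α cm.1 cm.2 := hcm.2
    have hapos : ∀ z k, 0 < α z k → 0 < a k := fun z k h => lt_of_lt_of_le h (hαa z k)
    set τ : ℝ := α cm.1 cm.2 / a cm.2 with hτ
    have hτpos : 0 < τ := div_pos hcmpos (hapos _ _ hcmpos)
    have hτle : ∀ z k, z < 2 → 0 < α z k → τ * a k ≤ α z k := by
      intro z k hz hpos
      have hk : k < K + 1 := by
        by_contra hk
        have h0 := haK k (by omega)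
        have h2 := hapos z k hpos
        rw [h0] at h2; exact lt_irrefl _ h2
      have hmem : (z, k) ∈ P :=
        Finset.mem_filter.2 ⟨Finset.mem_product.2 ⟨Finset.mem_range.2 hz, Finset.mem_range.2 hk⟩, hpos⟩
      have h := hmin (z, k) hmem
      have hak : 0 < a k := hapos z k hpos
      calc τ * a k = α cm.1 cm.2 / a cm.2 * a k := rfl
        _ ≤ α z k / a k * a k := mul_le_mul_of_nonneg_right h hak.le
        _ = α z k := div_mul_cancel₀ _ hak.ne'
    -- thresholds of the staircase of positive cells
    have hex : ∀ z, ∃ k, K < k ∨ 0 < α z k := fun z => ⟨K + 1, Or.inl (Nat.lt_succ_self K)⟩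
    set θ : ℕ → ℕ := fun z => Nat.find (hex z) with hθ
    have hθspec : ∀ z, K < θ z ∨ 0 < α z (θ z) := fun z => Nat.find_spec (hex z)
    have hθmin : ∀ z k, (K < k ∨ 0 < α z k) → θ z ≤ k := fun z k h => Nat.find_min' (hex z) h
    have t1 : ∀ z k, k < θ z → α z k = 0 := by
      intro z k hk
      have h : ¬ (K < k ∨ 0 < α z k) := Nat.find_min (hex z) hk
      push Not at h
      exact le_antisymm h.2 (hα0 z k)
    have t2 : ∀ z k, θ z ≤ k → 0 < a k → 0 < α z k := by
      intro z k hk hak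
      rcases hθspec z with h | h
      · have h0 := haK k (by omega); rw [h0] at hak; exact absurd hak (lt_irrefl _)
      · have hmono := hαk z (θ z) k hk
        have h1 : 0 < α z (θ z) * a k := mul_pos h hak
        have h2 : 0 < α z k * a (θ z) := lt_of_lt_of_le h1 hmono
        exact lt_of_le_of_ne (hα0 z k) (fun h0 => by rw [← h0, zero_mul] at h2; exact lt_irrefl _ h2)
    have t3 : θ 1 ≤ θ 0 := by
      refine hθmin 1 (θ 0) ?_
      rcases hθspec 0 with h | h
      · exact Or.inl h
      · exact Or.inr (lt_of_lt_of_le h (hαz _))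
    -- the peeled slot
    set s : ℕ → ℕ → ℝ := fun z k => if z < 2 ∧ θ z ≤ k then a k else 0 with hs
    set α' : ℕ → ℕ → ℝ := fun z k => α z k - τ * s z k with hα'
    have hs0 : ∀ z k, 0 ≤ s z k := fun z k => by simp only [hs]; split_ifs; exacts [ha k, le_rfl]
    have n0 : ∀ z k, 0 ≤ α' z k := by
      intro z k
      simp only [hα', hs]
      by_cases h : z < 2 ∧ θ z ≤ k
      · rw [if_pos h]
        rcases (ha k).eq_or_lt with h0 | h0
        · rw [← h0, mul_zero, sub_zero]; exact hα0 z k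
        · linarith [hτle z k h.1 (t2 z k h.2 h0)]
      · rw [if_neg h, mul_zero, sub_zero]; exact hα0 z k
    have na : ∀ z k, α' z k ≤ a k := fun z k => by
      simp only [hα']
      linarith [hαa z k, mul_nonneg hτpos.le (hs0 z k)]
    have nz : ∀ k, α' 0 k ≤ α' 1 k := by
      intro k
      by_cases h : θ 0 ≤ k
      · have h1 : θ 1 ≤ k := t3.trans h
        simp only [hα', hs]
        rw [if_pos ⟨by norm_num, h⟩, if_pos ⟨by norm_num, h1⟩]
        linarith [hαz k]
      · have e0 : α' 0 k = 0 := by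
          simp only [hα', hs]; rw [if_neg (fun h' => h h'.2), t1 0 k (not_le.1 h)]; ring
        rw [e0]; exact n0 1 k
    have nk : ∀ z k k', k ≤ k' → α' z k * a k' ≤ α' z k' * a k := by
      intro z k k' hkk'
      simp only [hα', hs]
      by_cases hz : z < 2
      · by_cases hk : θ z ≤ k
        · rw [if_pos ⟨hz, hk⟩, if_pos ⟨hz, hk.trans hkk'⟩]
          nlinarith [hαk z k k' hkk']
        · rw [if_neg (fun h => hk h.2), t1 z k (not_le.1 hk), mul_zero, sub_zero, zero_mul]
          have := n0 z k'
          simp only [hα', hs] at this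
          exact mul_nonneg this (ha k)
      · rw [if_neg (fun h => hz h.1), if_neg (fun h => hz h.1), mul_zero, sub_zero, sub_zero]
        exact hαk z k k' hkk'
    -- the positive cells decrease
    have hsub : G.filter (fun c => 0 < α' c.1 c.2) ⊆ P := by
      intro c hc
      have h := Finset.mem_filter.1 hc
      refine Finset.mem_filter.2 ⟨h.1, lt_of_lt_of_le h.2 ?_⟩
      simp only [hα']; linarith [mul_nonneg hτpos.le (hs0 c.1 c.2)]
    have hcm_out : cm ∉ G.filter (fun c => 0 < α' c.1 c.2) := by
      intro h
      have h2 := (Finset.mem_filter.1 h).2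
      have hθcm : θ cm.1 ≤ cm.2 := hθmin cm.1 cm.2 (Or.inr hcmpos)
      have hacm : 0 < a cm.2 := hapos _ _ hcmpos
      have e : α' cm.1 cm.2 = 0 := by
        simp only [hα', hs]; rw [if_pos ⟨hcmz, hθcm⟩, hτ, div_mul_cancel₀ _ hacm.ne']; ring
      rw [e] at h2; exact lt_irrefl _ h2
    have hcard' : (G.filter (fun c => 0 < α' c.1 c.2)).card ≤ n := by
      have hlt : (G.filter (fun c => 0 < α' c.1 c.2)).card < P.card :=
        Finset.card_lt_card ((Finset.ssubset_iff_of_subset hsub).2 ⟨cm, hcmP, hcm_out⟩)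
      omega
    have ih' := ih α' n0 na nz nk hcard'
    -- assemble: `Λ α = Λ α' + τ Λ s`, `Λ s = Λ (staircase θ) ≥ 0`
    have e1 : Λ α' = Λ α - τ * Λ s := hlin α s τ
    have e2 : Λ s = Λ (fun z k => if θ z ≤ k then a k else 0) :=
      hdep _ _ fun z k hz _ => by
        simp only [hs]
        by_cases h : θ z ≤ k
        · rw [if_pos ⟨hz, h⟩, if_pos h]
        · rw [if_neg (fun h' => h h'.2), if_neg h]
    have hs_nonneg : 0 ≤ Λ s := by rw [e2]; exact hstair θ t3
    nlinarith [ih', hs_nonneg, hτpos, e1]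


/-- Linearity of a triple sum in its summand. [folklore] -/
theorem sum3_lin (S T U : Finset ℕ) (f g : ℕ → ℕ → ℕ → ℝ) (τ : ℝ) :
    (∑ z ∈ S, ∑ k ∈ T, ∑ j ∈ U, (f z k j - τ * g z k j)) =
      (∑ z ∈ S, ∑ k ∈ T, ∑ j ∈ U, f z k j) - τ * ∑ z ∈ S, ∑ k ∈ T, ∑ j ∈ U, g z k j := by
  rw [Finset.mul_sum, ← Finset.sum_sub_distrib]
  refine Finset.sum_congr rfl fun z _ => ?_
  rw [Finset.mul_sum, ← Finset.sum_sub_distrib]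
  refine Finset.sum_congr rfl fun k _ => ?_
  rw [Finset.mul_sum, ← Finset.sum_sub_distrib]

/-- Linearity of a double sum in its summand. [folklore] -/
theorem sum2_lin (S T : Finset ℕ) (f g : ℕ → ℕ → ℝ) (τ : ℝ) :
    (∑ z ∈ S, ∑ k ∈ T, (f z k - τ * g z k)) = (∑ z ∈ S, ∑ k ∈ T, f z k) - τ * ∑ z ∈ S, ∑ k ∈ T, g z k := by
  rw [Finset.mul_sum, ← Finset.sum_sub_distrib]
  refine Finset.sum_congr rfl fun z _ => ?_
  rw [Finset.mul_sum, ← Finset.sum_sub_distrib]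

/-- **Collapse, staircase second slot.**  General first slot (`0 ≤ α ≤ a`, bit-monotone, cross-monotone in `k`), staircase second slot
`b j·[φ z ≤ j]`; log-concave private chains.  By the layer-cake lemma in the first slot over `stair_stair_nonneg`. [this work] -/
theorem collapse_stairSnd_nonneg (K J t : ℕ) (c a b : ℕ → ℝ) (α : ℕ → ℕ → ℝ) (φ : ℕ → ℕ)
    (hc : ∀ z, 0 ≤ c z) (hc1 : c 0 + c 1 = 1)
    (ha : ∀ k, 0 ≤ a k) (haK : ∀ k, K < k → a k = 0) (halc : ∀ i j, i < j → a i * a (j + 1) ≤ a (i + 1) * a j)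
    (hb : ∀ j, 0 ≤ b j) (hbJ : ∀ j, J < j → b j = 0) (hblc : ∀ i j, i < j → b i * b (j + 1) ≤ b (i + 1) * b j)
    (hα0 : ∀ z k, 0 ≤ α z k) (hαa : ∀ z k, α z k ≤ a k) (hαz : ∀ k, α 0 k ≤ α 1 k)
    (hαk : ∀ z k k', k ≤ k' → α z k * a k' ≤ α z k' * a k) (hφ : φ 1 ≤ φ 0) :
    0 ≤ (∑ z ∈ range 2, ∑ k ∈ range (K + 1), ∑ j ∈ range (J + 1), if z + k + j < t then c z * a k * b j else 0) *
          (∑ z ∈ range 2, ∑ k ∈ range (K + 1), ∑ j ∈ range (J + 1),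
            if z + k + j < t then 0 else c z * α z k * (if φ z ≤ j then b j else 0))
        + (∑ z ∈ range 2, ∑ k ∈ range (K + 1), ∑ j ∈ range (J + 1), if z + k + j < t then c z * α z k * b j else 0) *
          (∑ z ∈ range 2, ∑ k ∈ range (K + 1), ∑ j ∈ range (J + 1),
            if z + k + j < t then c z * a k * (if φ z ≤ j then b j else 0) else 0)
        - (∑ z ∈ range 2, ∑ k ∈ range (K + 1), ∑ j ∈ range (J + 1), if z + k + j < t then c z * a k * b j else 0) *
          (∑ z ∈ range 2, ∑ k ∈ range (K + 1), c z * α z k) *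
          (∑ z ∈ range 2, ∑ j ∈ range (J + 1), c z * (if φ z ≤ j then b j else 0)) := by
  have key := layerCake K a ha haK
    (fun α' => (∑ z ∈ range 2, ∑ k ∈ range (K + 1), ∑ j ∈ range (J + 1), if z + k + j < t then c z * a k * b j else 0) *
          (∑ z ∈ range 2, ∑ k ∈ range (K + 1), ∑ j ∈ range (J + 1),
            if z + k + j < t then 0 else c z * α' z k * (if φ z ≤ j then b j else 0))
        + (∑ z ∈ range 2, ∑ k ∈ range (K + 1), ∑ j ∈ range (J + 1), if z + k + j < t then c z * α' z k * b j else 0) *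
          (∑ z ∈ range 2, ∑ k ∈ range (K + 1), ∑ j ∈ range (J + 1),
            if z + k + j < t then c z * a k * (if φ z ≤ j then b j else 0) else 0)
        - (∑ z ∈ range 2, ∑ k ∈ range (K + 1), ∑ j ∈ range (J + 1), if z + k + j < t then c z * a k * b j else 0) *
          (∑ z ∈ range 2, ∑ k ∈ range (K + 1), c z * α' z k) *
          (∑ z ∈ range 2, ∑ j ∈ range (J + 1), c z * (if φ z ≤ j then b j else 0))) ?_ ?_ ?_ α hα0 hαa hαz hαk
  · exact key
  · -- dependence on grid values only
    intro α₁ α₂ h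
    have e1 : (∑ z ∈ range 2, ∑ k ∈ range (K + 1), ∑ j ∈ range (J + 1),
        if z + k + j < t then 0 else c z * α₁ z k * (if φ z ≤ j then b j else 0)) =
        ∑ z ∈ range 2, ∑ k ∈ range (K + 1), ∑ j ∈ range (J + 1),
        if z + k + j < t then 0 else c z * α₂ z k * (if φ z ≤ j then b j else 0) :=
      Finset.sum_congr rfl fun z hz => Finset.sum_congr rfl fun k hk => Finset.sum_congr rfl fun j _ => by
        rw [h z k (Finset.mem_range.1 hz) (Finset.mem_range.1 hk)]
    have e2 : (∑ z ∈ range 2, ∑ k ∈ range (K + 1), ∑ j ∈ range (J + 1), if z + k + j < t then c z * α₁ z k * b j else 0) =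
        ∑ z ∈ range 2, ∑ k ∈ range (K + 1), ∑ j ∈ range (J + 1), if z + k + j < t then c z * α₂ z k * b j else 0 :=
      Finset.sum_congr rfl fun z hz => Finset.sum_congr rfl fun k hk => Finset.sum_congr rfl fun j _ => by
        rw [h z k (Finset.mem_range.1 hz) (Finset.mem_range.1 hk)]
    have e3 : (∑ z ∈ range 2, ∑ k ∈ range (K + 1), c z * α₁ z k) = ∑ z ∈ range 2, ∑ k ∈ range (K + 1), c z * α₂ z k :=
      Finset.sum_congr rfl fun z hz => Finset.sum_congr rfl fun k hk => by
        rw [h z k (Finset.mem_range.1 hz) (Finset.mem_range.1 hk)]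
    rw [e1, e2, e3]
  · -- linearity
    intro α₁ s τ
    simp only []
    have e1 : (∑ z ∈ range 2, ∑ k ∈ range (K + 1), ∑ j ∈ range (J + 1),
        if z + k + j < t then 0 else c z * (α₁ z k - τ * s z k) * (if φ z ≤ j then b j else 0)) =
        (∑ z ∈ range 2, ∑ k ∈ range (K + 1), ∑ j ∈ range (J + 1),
          if z + k + j < t then 0 else c z * α₁ z k * (if φ z ≤ j then b j else 0)) -
        τ * ∑ z ∈ range 2, ∑ k ∈ range (K + 1), ∑ j ∈ range (J + 1),
          if z + k + j < t then 0 else c z * s z k * (if φ z ≤ j then b j else 0) := by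
      rw [← sum3_lin]
      exact Finset.sum_congr rfl fun z _ => Finset.sum_congr rfl fun k _ => Finset.sum_congr rfl fun j _ => by
        split_ifs <;> ring
    have e2 : (∑ z ∈ range 2, ∑ k ∈ range (K + 1), ∑ j ∈ range (J + 1),
        if z + k + j < t then c z * (α₁ z k - τ * s z k) * b j else 0) =
        (∑ z ∈ range 2, ∑ k ∈ range (K + 1), ∑ j ∈ range (J + 1), if z + k + j < t then c z * α₁ z k * b j else 0) -
        τ * ∑ z ∈ range 2, ∑ k ∈ range (K + 1), ∑ j ∈ range (J + 1), if z + k + j < t then c z * s z k * b j else 0 := by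
      rw [← sum3_lin]
      exact Finset.sum_congr rfl fun z _ => Finset.sum_congr rfl fun k _ => Finset.sum_congr rfl fun j _ => by
        split_ifs <;> ring
    have e3 : (∑ z ∈ range 2, ∑ k ∈ range (K + 1), c z * (α₁ z k - τ * s z k)) =
        (∑ z ∈ range 2, ∑ k ∈ range (K + 1), c z * α₁ z k) - τ * ∑ z ∈ range 2, ∑ k ∈ range (K + 1), c z * s z k := by
      rw [← sum2_lin]
      exact Finset.sum_congr rfl fun z _ => Finset.sum_congr rfl fun k _ => by ring
    rw [e1, e2, e3]; ring
  · -- staircases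
    intro θ hθ
    exact stair_stair_nonneg K J t c a b θ φ hc hc1 ha haK halc hb hbJ hblc hθ hφ

/-- **THREE-CHAIN COLLAPSE LEMMA, ONE SHARED BIT (mass form).**  Bit weights `c 0 + c 1 = 1`; private chains `k ∈ {0..K}` and
`j ∈ {0..J}` with nonnegative, pairwise LOG-CONCAVE weights `a`, `b` (supported in the ranges); slot masses `0 ≤ α z k ≤ a k` and
`0 ≤ β z j ≤ b j`, each monotone in the bit and cross-monotone in its private index.  Then the collapse functional
`ℓ·Σ_H c α β + (Σ_L c α b)(Σ_L c a β) − ℓ·(Σ c α)(Σ c β) ≥ 0`, i.e. `Cov(f,g) ≥ P(L)·Cov(f,g | L)` for `f = f(Z,X)`, `g = g(Z,Y)`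
increasing, `L = {Z+X+Y ≤ s}` (memo §1, LEMMA 2).  Log-concavity cannot be dropped. [this work] -/
theorem collapse_nonneg (K J t : ℕ) (c a b : ℕ → ℝ) (α β : ℕ → ℕ → ℝ)
    (hc : ∀ z, 0 ≤ c z) (hc1 : c 0 + c 1 = 1)
    (ha : ∀ k, 0 ≤ a k) (haK : ∀ k, K < k → a k = 0) (halc : ∀ i j, i < j → a i * a (j + 1) ≤ a (i + 1) * a j)
    (hb : ∀ j, 0 ≤ b j) (hbJ : ∀ j, J < j → b j = 0) (hblc : ∀ i j, i < j → b i * b (j + 1) ≤ b (i + 1) * b j)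
    (hα0 : ∀ z k, 0 ≤ α z k) (hαa : ∀ z k, α z k ≤ a k) (hαz : ∀ k, α 0 k ≤ α 1 k)
    (hαk : ∀ z k k', k ≤ k' → α z k * a k' ≤ α z k' * a k)
    (hβ0 : ∀ z j, 0 ≤ β z j) (hβb : ∀ z j, β z j ≤ b j) (hβz : ∀ j, β 0 j ≤ β 1 j)
    (hβj : ∀ z j j', j ≤ j' → β z j * b j' ≤ β z j' * b j) :
    0 ≤ (∑ z ∈ range 2, ∑ k ∈ range (K + 1), ∑ j ∈ range (J + 1), if z + k + j < t then c z * a k * b j else 0) *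
          (∑ z ∈ range 2, ∑ k ∈ range (K + 1), ∑ j ∈ range (J + 1), if z + k + j < t then 0 else c z * α z k * β z j)
        + (∑ z ∈ range 2, ∑ k ∈ range (K + 1), ∑ j ∈ range (J + 1), if z + k + j < t then c z * α z k * b j else 0) *
          (∑ z ∈ range 2, ∑ k ∈ range (K + 1), ∑ j ∈ range (J + 1), if z + k + j < t then c z * a k * β z j else 0)
        - (∑ z ∈ range 2, ∑ k ∈ range (K + 1), ∑ j ∈ range (J + 1), if z + k + j < t then c z * a k * b j else 0) *
          (∑ z ∈ range 2, ∑ k ∈ range (K + 1), c z * α z k) * (∑ z ∈ range 2, ∑ j ∈ range (J + 1), c z * β z j) := by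
  have key := layerCake J b hb hbJ
    (fun β' => (∑ z ∈ range 2, ∑ k ∈ range (K + 1), ∑ j ∈ range (J + 1), if z + k + j < t then c z * a k * b j else 0) *
          (∑ z ∈ range 2, ∑ k ∈ range (K + 1), ∑ j ∈ range (J + 1), if z + k + j < t then 0 else c z * α z k * β' z j)
        + (∑ z ∈ range 2, ∑ k ∈ range (K + 1), ∑ j ∈ range (J + 1), if z + k + j < t then c z * α z k * b j else 0) *
          (∑ z ∈ range 2, ∑ k ∈ range (K + 1), ∑ j ∈ range (J + 1), if z + k + j < t then c z * a k * β' z j else 0)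
        - (∑ z ∈ range 2, ∑ k ∈ range (K + 1), ∑ j ∈ range (J + 1), if z + k + j < t then c z * a k * b j else 0) *
          (∑ z ∈ range 2, ∑ k ∈ range (K + 1), c z * α z k) * (∑ z ∈ range 2, ∑ j ∈ range (J + 1), c z * β' z j))
    ?_ ?_ ?_ β hβ0 hβb hβz hβj
  · exact key
  · intro β₁ β₂ h
    have e1 : (∑ z ∈ range 2, ∑ k ∈ range (K + 1), ∑ j ∈ range (J + 1),
        if z + k + j < t then 0 else c z * α z k * β₁ z j) =
        ∑ z ∈ range 2, ∑ k ∈ range (K + 1), ∑ j ∈ range (J + 1), if z + k + j < t then 0 else c z * α z k * β₂ z j :=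
      Finset.sum_congr rfl fun z hz => Finset.sum_congr rfl fun k _ => Finset.sum_congr rfl fun j hj => by
        rw [h z j (Finset.mem_range.1 hz) (Finset.mem_range.1 hj)]
    have e2 : (∑ z ∈ range 2, ∑ k ∈ range (K + 1), ∑ j ∈ range (J + 1), if z + k + j < t then c z * a k * β₁ z j else 0) =
        ∑ z ∈ range 2, ∑ k ∈ range (K + 1), ∑ j ∈ range (J + 1), if z + k + j < t then c z * a k * β₂ z j else 0 :=
      Finset.sum_congr rfl fun z hz => Finset.sum_congr rfl fun k _ => Finset.sum_congr rfl fun j hj => by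
        rw [h z j (Finset.mem_range.1 hz) (Finset.mem_range.1 hj)]
    have e3 : (∑ z ∈ range 2, ∑ j ∈ range (J + 1), c z * β₁ z j) = ∑ z ∈ range 2, ∑ j ∈ range (J + 1), c z * β₂ z j :=
      Finset.sum_congr rfl fun z hz => Finset.sum_congr rfl fun j hj => by
        rw [h z j (Finset.mem_range.1 hz) (Finset.mem_range.1 hj)]
    rw [e1, e2, e3]
  · intro β₁ s τ
    simp only []
    have e1 : (∑ z ∈ range 2, ∑ k ∈ range (K + 1), ∑ j ∈ range (J + 1),
        if z + k + j < t then 0 else c z * α z k * (β₁ z j - τ * s z j)) =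
        (∑ z ∈ range 2, ∑ k ∈ range (K + 1), ∑ j ∈ range (J + 1), if z + k + j < t then 0 else c z * α z k * β₁ z j) -
        τ * ∑ z ∈ range 2, ∑ k ∈ range (K + 1), ∑ j ∈ range (J + 1), if z + k + j < t then 0 else c z * α z k * s z j := by
      rw [← sum3_lin]
      exact Finset.sum_congr rfl fun z _ => Finset.sum_congr rfl fun k _ => Finset.sum_congr rfl fun j _ => by
        split_ifs <;> ring
    have e2 : (∑ z ∈ range 2, ∑ k ∈ range (K + 1), ∑ j ∈ range (J + 1),
        if z + k + j < t then c z * a k * (β₁ z j - τ * s z j) else 0) =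
        (∑ z ∈ range 2, ∑ k ∈ range (K + 1), ∑ j ∈ range (J + 1), if z + k + j < t then c z * a k * β₁ z j else 0) -
        τ * ∑ z ∈ range 2, ∑ k ∈ range (K + 1), ∑ j ∈ range (J + 1), if z + k + j < t then c z * a k * s z j else 0 := by
      rw [← sum3_lin]
      exact Finset.sum_congr rfl fun z _ => Finset.sum_congr rfl fun k _ => Finset.sum_congr rfl fun j _ => by
        split_ifs <;> ring
    have e3 : (∑ z ∈ range 2, ∑ j ∈ range (J + 1), c z * (β₁ z j - τ * s z j)) =
        (∑ z ∈ range 2, ∑ j ∈ range (J + 1), c z * β₁ z j) - τ * ∑ z ∈ range 2, ∑ j ∈ range (J + 1), c z * s z j := by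
      rw [← sum2_lin]
      exact Finset.sum_congr rfl fun z _ => Finset.sum_congr rfl fun j _ => by ring
    rw [e1, e2, e3]; ring
  · intro φ hφ
    exact collapse_stairSnd_nonneg K J t c a b α φ hc hc1 ha haK halc hb hbJ hblc hα0 hαa hαz hαk hφ

end ThreeChain

end SahiOneStep

end Summit.CriticalPhenomena.PercolationContinuityZ3.Theorems
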